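import Literature.MathematicalPhysics.QuantumFieldTheory.Balaban1983to89.T3MinimiserStabilityReduction
import Literature.MathematicalPhysics.QuantumFieldTheory.Balaban1983to89.T3PrintedRegularMinimiser
import Literature.MathematicalPhysics.QuantumFieldTheory.Balaban1983to89.T3OrbitAverage
import Literature.MathematicalPhysics.QuantumFieldTheory.Balaban1983to89.B12ContinuousTransportInvariance
import Literature.MathematicalPhysics.QuantumFieldTheory.Balaban1983to89.Node00.CanonicalTransportOfRecord
import Summits.QuantumFields.YangMills.Theorems.FluctuationComparisonRegPrIntLOddsLedgerReduction
import Summits.QuantumFields.YangMills.Theorems.FluctuationComparisonRegPrIntLOddsLedgerTopIncrement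
import HarnessLib

/-!
# LINE g20-2 «ODDS LEDGER» — the large-field 4-point remainder LFR♯ᶜ by a SCALE-TELESCOPED LEDGER OF CONDITIONAL LARGE-FIELD ODDS
(ideator `ym-r3-idea-1` g20, lens «control»; crux `stmt-QuantumFields-20520` = `UnitScaleTilt.FluctuationComparisonRegPrIntL`, rung R3 = continuum SU(2) YM₃ on T³)

TARGET (concluded BY NAME): the S2β organ **LFR♯ᶜ** `LargeFieldFourPtCan` of LINE g18-1 `Lines/semiclassical_s2beta.lean` (v10.1 §2, consumed there by
✓`fluctuationPartSmall_of_semiclassicalCan (h3 : LargeFieldFourPtCan)`), restated VERBATIM in §0 with everything it mentions (`heightDensityCan`, `fourPt`).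
Until now LFR♯ᶜ had exactly one hand: the IDENTITY-form chain LFG → LFRᶜ → LFR♯ᶜ (LINE g19-1 `Lines/largefield_gas.lean`: the full ∕ small-history density
ratio AS a hard-core V-local KP gas, `log` by the KP lemma) — an identity form that the organ's own docstring records as NOT PRINTED for `d = 3`
([Balaban1985UV3] prints the inequality (41)/(47) only).  This line is the INEQUALITY-currency door.

THE LEVER (control lens: a per-scale controlling quantity with a summable budget).  Fix the run `K` and the height `J ≤ K`.  Filter Bałaban's small-history
event by DEPTH: `histGoodBelow θ K J M` := "the `M` finest averaged fields of the history are small" (`M = 0`: no constraint = `univ`; `M > K − J`: all of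
`histGood θ K J`; §1, PROVED).  The canonical partial densities `q_M := heightDensityCan^{histGoodBelow M}` telescope (§2, PROVED — pure algebra of `Real.log`,
no positivity needed):
  `log ρ − log q^{histGood} = (log ρ − log q_0) + Σ_{M ≤ K−J} ℓ_M`,  `ℓ_M := log q_M − log q_{M+1}`  (`oddsInc`)
and `ℓ_M(U) = −log P_U(depth-M field small | finer fields small)` is the CONDITIONAL LARGE-FIELD ODDS OF ONE SCALE given the window field `U` at height `J`.
The connected 4-point `fourPt` is additive (PROVED), so LFR♯ᶜ follows from three organ rows (§3) by a PROVED composition (§4):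
  VERS  `FullVersionConstCan`        (S/M) — on the window, `log ρ − log q_0` is CONSTANT (`ρ` and `q_0 = canonVersion(heightDensity^{univ})` are two versions of
                                             `dν_{K,J}/dHaar` up to the factor `Z_K`; the canonical version equals every continuous version on the open window:
                                             `Node00.canonVersion_eqOn_of_continuousOn`, `…_congr_ae`) ⇒ its `fourPt` vanishes;
  PREG  `PartialWindowPositivityCan` (S/M) — every partial canonical density `q_M` is positive on the window (WREG's pens for `histGoodBelow M` instead of `histGood`);
  LEV   `LevelOddsLedgerCan`         (XL, this line's organ) — PER-SCALE PINNED BUDGET: `|fourPt ℓ_M (b,b′)| ≤ w_J(K−J−M)·e^{−κ·tdist(b,b′)}` with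
                                             `Σ_{r<R} w_J(r) ≤ ψ_J` for all `R`, `J·ψ_J → 0` — print's mechanism read scale by scale: a depth-`M` plaquette is large
                                             while all finer fields are small only by a GAUSSIAN LARGE DEVIATION of the fluctuation field (tail `e^{−c·p(g_{J+r})²}`,
                                             [Balaban1985UV3] (38)–(40) p.266), against the ENTROPY `L^{3r}` of depth-`M` plaquettes per height-`J` cell, times the
                                             MIXING of the conditional fluctuation measure in the height-`J` background (`e^{−κ·tdist}`, unit gap of the averaging
                                             constraint): `w_J(r) ≍ L^{3r}·e^{−c b₀²·p(g_{J+r})²}`, summable and super-exponentially small in `J` once `p₀ ≥ pS`.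
  ✓ `largeFieldFourPtCan_of_ledger : LedgerSuffices` (`:= FullVersionConstCan → PartialWindowPositivityCan → LevelOddsLedgerCan → LargeFieldFourPtCan`;
    §4: telescope, `fourPt` additivity, VERS kills the version term, triangle inequality, `Finset.sum_range_reflect`, the uniform partial-sum budget)
    and ✓ `largeFieldFourPtCan_of_stubs : LargeFieldFourPtCan` (the registered skeleton theorem).
First rung (hands' entry): `DepthOneOddsCan` (= LEV on the runs `K = J + 1`: ONE free level above the window, the increment `M = 0` is the UNCONDITIONED
odds of a large run-`(J+1)` plaquette under the ONE-STEP constrained fluctuation measure — Gaussian tail × one-step mixing, the tree's one-step tools are the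
pens) ✓ `depthOneOdds_of_ledger`.

WHY EASIER / WHY NEW (vs the listed hands).  LFG asks for an IDENTITY `ρ = e^c·q^{hist}·Ξ(w)` with ONE V-local hard-core gas carrying all scales at once and a
KP norm — Möbius inversion, analyticity of activities, KP-majorant uniformity (the wall of LOCATE-LFG §2).  LEV asks, one scale at a time, for an INEQUALITY on
a conditional probability: Peierls/Chernoff tail × entropy × a mixing (covariance-decay) estimate — the three quantities constructive QFT controls without any
polymer identity ([Balaban1985UV3] (38)–(47) are inequalities).  The telescoping is over the CONSTRAINT DEPTH at FIXED run `K` — not over the run depth `K`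
(that telescoping imports the two-run row, crux 19935; dead line of g20's design pass) and not the `λ`-flow of LINE g20-1.  Same honesty clause as g20-1: the
multi-scale large-field control (free coarser levels inside each increment's conditional measure) is the conserved wall, counted once, now in inequality form.

Sorries = {VERS `stub_fullVersionConstCan` (S/M), PREG `stub_partialWindowPositivityCan` (S/M), LEV `stub_levelOddsLedgerCan` (XL)}; 0 elsewhere.  No summit
is proved by a line; `YM3TorusSU2` is NOT proved (the package's other inputs S1a, 26243, S2α′, O1 and S2β's other organs EXW, GAP♯, LAPLACE/1L4ᶜ, H4ᶜ stay
open); nothing of Bałaban's asserted; rung R3 (YM₃ on T³) — NOT d = 4, NOT infinite volume, NOT a mass gap, NOT Clay.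
-/

noncomputable section

open MeasureTheory Filter Topology Set
open Literature.MathematicalPhysics.QuantumFieldTheory.Balaban1983to89
open Literature.MathematicalPhysics.QuantumFieldTheory.Balaban1983to89.T3ContinuumYM3Torus
open Literature.MathematicalPhysics.QuantumFieldTheory.Balaban1983to89.T3NestedUnitLaws
open Literature.MathematicalPhysics.QuantumFieldTheory.Balaban1983to89.T3UnitLawDensityEML
open Literature.MathematicalPhysics.QuantumFieldTheory.Balaban1983to89.T3UnitScaleTilt
open Literature.MathematicalPhysics.QuantumFieldTheory.Balaban1983to89.T3TiltDescent
open Literature.MathematicalPhysics.QuantumFieldTheory.Balaban1983to89.T3PrintedRegularMinimiser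
open Literature.MathematicalPhysics.QuantumFieldTheory.Balaban1983to89.T3ConstrainedMinimiser (fibre)
open Literature.MathematicalPhysics.QuantumFieldTheory.Balaban1983to89.T3LevelShift
open Literature.MathematicalPhysics.QuantumFieldTheory.Balaban1983to89.Missing
open Literature.MathematicalPhysics.QuantumFieldTheory.Balaban1983to89.T4Continuum

namespace Summit.QuantumFields.YangMills.Cruxes.FluctuationComparisonRegPrIntL.RunPairOrgan.OddsLedger

/-! ## §0a The canonical version of the restricted height density (verbatim from LINE g18-1 v10.1 §1 = g19-1/g19-2/g20-1 §0a) -/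

section Canonical

variable (F : T3Family) (γ : ℝ) {J K : ℕ} (hJK : J ≤ K) (S : Set (GaugeField (F.P K) 0 (Matrix.specialUnitaryGroup (Fin 2) ℂ)))

/-- **THE CANONICAL VERSION OF BAŁABAN'S RESTRICTED DENSITY AT HEIGHT `K − J`** read on the `J`-th tower's finest lattice: the trunk's `heightDensity`
(a chosen Radon–Nikodym version) replaced by `Node00.canonVersion` of its a.e.-class for product Haar — continuous on the maximal open set carrying a
continuous representative and equal there to every such representative. [cite: Balaban1985UV3, (2) p.256 and (41) p.266] -/
def heightDensityCan (V : GaugeField (F.P J) 0 (Matrix.specialUnitaryGroup (Fin 2) ℂ)) : ℝ :=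
  Node00.canonVersion (fieldMeasure (F.P J) 0 (Matrix.specialUnitaryGroup (Fin 2) ℂ)) (heightDensity F γ hJK S) V

end Canonical

/-! ## §0b The connected 4-point and the TARGET organ LFR♯ᶜ (verbatim from LINE g18-1 `Lines/semiclassical_s2beta.lean` v10.1 §2) -/

section Target

/-- The connected 4-point (mixed second difference) — verbatim from v3a. [cite: Balaban1985UV3, (41) p.266] -/
def fourPt {X : Type*} (f : X → ℝ) (U V W Z : X) : ℝ := (f U - f V) - (f W - f Z)

/-- **LFR♯ᶜ · LARGE-FIELD 4-POINT REMAINDER, OVER THE CANONICAL VERSION** (verbatim from LINE g18-1 v10.1): for every continuous positive window version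
`ρ` of the full nested law, `log ρ − log heightDensityCan^{histGood}` has κ-clustered connected 4-points `≤ ψ J`, `J·ψ J → 0`, depth-uniform, given positivity
of the canonical small-history density on the window. [cite: Balaban1988Convergent, §2 (2.18)-(2.27); Balaban1989LargeFieldI, §1] -/
def LargeFieldFourPtCan : Prop :=
  ∀ (L : ℕ), ∃ pS : ℝ, ∀ (b₀ p₀ : ℝ), 0 < b₀ → pS ≤ p₀ → 0 < p₀ →
    ∃ γ₁ : ℝ, 0 < γ₁ ∧ ∃ κ : ℝ, 0 < κ ∧ ∀ (F : T3Family) (γ : ℝ), F.L = L → 0 < γ → γ ≤ γ₁ →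
      ∃ ψ : ℕ → ℝ, (∀ J, 0 ≤ ψ J) ∧ Tendsto (fun J : ℕ => (J : ℝ) * ψ J) atTop (𝓝 0) ∧
        ∀ (ν : ℕ → (j : ℕ) → Measure (GaugeField (F.P j) 0 (Matrix.specialUnitaryGroup (Fin 2) ℂ))),
          (∀ K, ν K K = T4GenFunBounds.gibbsMeasure (F.P K) ((F.scheme ℰp γ).β K)) →
          (∀ K j, j < K → ν K j = Measure.map (descend F ℰp j) (ν K (j + 1))) →
          ∀ (J K : ℕ) (hJK : J ≤ K) (ρ : GaugeField (F.P J) 0 (Matrix.specialUnitaryGroup (Fin 2) ℂ) → ℝ),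
            (∀ U, PlaqSmall (θBal F.L γ b₀ p₀ J) U → 0 < ρ U) →
            ν K J = (fieldMeasure _ _ _).withDensity (fun U => ENNReal.ofReal (ρ U)) →
            ContinuousOn ρ {U | PlaqSmall (θBal F.L γ b₀ p₀ J) U} →
            (∀ U : GaugeField (F.P J) 0 (Matrix.specialUnitaryGroup (Fin 2) ℂ), PlaqSmall (θBal F.L γ b₀ p₀ J) U →
                0 < heightDensityCan F γ hJK (histGood F ℰp (θBal F.L γ b₀ p₀) K J) U) →
            ∀ (b b' : PBond (F.P J) 0) (U V W Z : GaugeField (F.P J) 0 (Matrix.specialUnitaryGroup (Fin 2) ℂ)),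
              PlaqSmall (θBal F.L γ b₀ p₀ J) U → PlaqSmall (θBal F.L γ b₀ p₀ J) V →
              PlaqSmall (θBal F.L γ b₀ p₀ J) W → PlaqSmall (θBal F.L γ b₀ p₀ J) Z →
              (∀ e, e ≠ b → U e = V e) → (∀ e, e ≠ b' → U e = W e) → (∀ e, e ≠ b' → V e = Z e) → (∀ e, e ≠ b → W e = Z e) →
              |fourPt (fun U => Real.log (ρ U) - Real.log (heightDensityCan F γ hJK (histGood F ℰp (θBal F.L γ b₀ p₀) K J) U)) U V W Z|
                ≤ ψ J * Real.exp (-(κ * (b.src.tdist b'.src : ℝ)))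

/-- `fourPt` is additive. [folklore] -/
theorem fourPt_add {X : Type*} (f g : X → ℝ) (U V W Z : X) :
    fourPt (fun x => f x + g x) U V W Z = fourPt f U V W Z + fourPt g U V W Z := by
  unfold fourPt; ring

/-- `fourPt` commutes with finite sums. [folklore] -/
theorem fourPt_finset_sum {X ι : Type*} (s : Finset ι) (f : ι → X → ℝ) (U V W Z : X) :
    fourPt (fun x => ∑ i ∈ s, f i x) U V W Z = ∑ i ∈ s, fourPt (f i) U V W Z := by
  unfold fourPt
  simp only [Finset.sum_sub_distrib]

/-- `fourPt` of a function constant on the four points vanishes. [folklore] -/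
theorem fourPt_eq_zero_of_const {X : Type*} (f : X → ℝ) (c : ℝ) {U V W Z : X}
    (hU : f U = c) (hV : f V = c) (hW : f W = c) (hZ : f Z = c) : fourPt f U V W Z = 0 := by
  unfold fourPt; rw [hU, hV, hW, hZ]; ring

end Target

/-! ## §1 The DEPTH-FILTERED small-history events (PROVED bookkeeping)

`histGoodBelow θ K n M` constrains only the averaging depths `j < M` (the `M` finest fields of the run-`K` history); `M = 0` is no constraint, `M > K − n`
is all of Bałaban's `histGood θ K n`.  [cite: Balaban1985UV3, (7) p.257] -/

section Events

variable (F : T3Family)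

/-- **THE DEPTH-FILTERED UV-SMALL-HISTORY EVENT**: every block-averaged field `avg^{j}(U)` at the depths `j < M` with `j + n ≤ K` has all its plaquette
variables within `θ(K − j)` of `1` (the same clause as `histGood`, filtered by `j < M`). [cite: Balaban1985UV3, (7) p.257] -/
def histGoodBelow (θ : ℕ → ℝ) (K n M : ℕ) : Set (GaugeField (F.P K) 0 (Matrix.specialUnitaryGroup (Fin 2) ℂ)) :=
  {U | ∀ j, j + n ≤ K → j < M → PlaqSmall (θ (K - j))
    (Averaging.iter (fun i => BlockAveraging.blockAvg (P := F.P K) (j := i) ℰp) j U)}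

/-- No depth constrained: everything. [cite: Balaban1985UV3, (7) p.257] -/
theorem histGoodBelow_zero (θ : ℕ → ℝ) (K n : ℕ) : histGoodBelow F θ K n 0 = Set.univ := by
  ext U
  simp [histGoodBelow]

/-- All depths constrained: Bałaban's event. [cite: Balaban1985UV3, (7) p.257] -/
theorem histGoodBelow_of_lt (θ : ℕ → ℝ) {K n M : ℕ} (h : K - n < M) : histGoodBelow F θ K n M = histGood F ℰp θ K n := by
  ext U
  simp only [histGoodBelow, histGood, Set.mem_setOf_eq]
  constructor
  · intro hU j hj
    exact hU j hj (by omega)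
  · intro hU j hj _
    exact hU j hj

/-- The filtration is decreasing in the depth. [cite: Balaban1985UV3, (7) p.257] -/
theorem histGoodBelow_antitone (θ : ℕ → ℝ) (K n : ℕ) {M M' : ℕ} (h : M ≤ M') :
    histGoodBelow F θ K n M' ⊆ histGoodBelow F θ K n M := by
  intro U hU j hj hjM
  exact hU j hj (lt_of_lt_of_le hjM h)

/-- The smallest event of the filtration is contained in every member. [cite: Balaban1985UV3, (7) p.257] -/
theorem histGood_subset_histGoodBelow (θ : ℕ → ℝ) (K n M : ℕ) : histGood F ℰp θ K n ⊆ histGoodBelow F θ K n M := by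
  rw [← histGoodBelow_of_lt F θ (Nat.lt_succ_of_le (le_max_left (K - n) M))]
  exact histGoodBelow_antitone F θ K n ((le_max_right _ _).trans (Nat.le_succ _))

end Events

/-! ## §2 THE ODDS LEDGER: partial canonical densities, per-scale increments, the telescope (PROVED) -/

section Ledger

variable (F : T3Family) (γ b₀ p₀ : ℝ) {J K : ℕ} (hJK : J ≤ K)

/-- **THE PARTIAL CANONICAL DENSITY `q_M`**: the canonical version of the height-`J` density of the run-`K` Gibbs weight restricted to histories whose `M`
finest averaged fields are small. [cite: Balaban1985UV3, (2) p.256, (7) p.257] -/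
def partialDensityCan (M : ℕ) (U : GaugeField (F.P J) 0 (Matrix.specialUnitaryGroup (Fin 2) ℂ)) : ℝ :=
  heightDensityCan F γ hJK (histGoodBelow F (θBal F.L γ b₀ p₀) K J M) U

/-- **THE LEDGER INCREMENT OF SCALE `M`**: `ℓ_M(U) := log q_M(U) − log q_{M+1}(U) = −log P_U(depth-M averaged field small | finer fields small)` — the
conditional large-field odds of one scale above the window field `U`. [cite: Balaban1985UV3, (38)-(41) p.266] -/
def oddsInc (M : ℕ) (U : GaugeField (F.P J) 0 (Matrix.specialUnitaryGroup (Fin 2) ℂ)) : ℝ :=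
  Real.log (partialDensityCan F γ b₀ p₀ hJK M U) - Real.log (partialDensityCan F γ b₀ p₀ hJK (M + 1) U)

/-- `q_0 = heightDensityCan^{univ}` (the full density's canonical version, unnormalised). [cite: Balaban1985UV3, (2) p.256] -/
theorem partialDensityCan_zero (U : GaugeField (F.P J) 0 (Matrix.specialUnitaryGroup (Fin 2) ℂ)) :
    partialDensityCan F γ b₀ p₀ hJK 0 U = heightDensityCan F γ hJK Set.univ U := by
  simp [partialDensityCan, histGoodBelow_zero]

/-- `q_M = heightDensityCan^{histGood}` for `M > K − J`. [cite: Balaban1985UV3, (7) p.257] -/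
theorem partialDensityCan_of_lt {M : ℕ} (h : K - J < M) (U : GaugeField (F.P J) 0 (Matrix.specialUnitaryGroup (Fin 2) ℂ)) :
    partialDensityCan F γ b₀ p₀ hJK M U = heightDensityCan F γ hJK (histGood F ℰp (θBal F.L γ b₀ p₀) K J) U := by
  simp [partialDensityCan, histGoodBelow_of_lt F _ h]

/-- Above the height-`J` scale the increments vanish identically. [cite: Balaban1985UV3, (7) p.257] -/
theorem oddsInc_eq_zero_of_lt {M : ℕ} (h : K - J < M) (U : GaugeField (F.P J) 0 (Matrix.specialUnitaryGroup (Fin 2) ℂ)) :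
    oddsInc F γ b₀ p₀ hJK M U = 0 := by
  simp [oddsInc, partialDensityCan_of_lt F γ b₀ p₀ hJK h, partialDensityCan_of_lt F γ b₀ p₀ hJK (Nat.lt_succ_of_lt h)]

/-- **THE TELESCOPE** (pure algebra of `Real.log`, no positivity used): `Σ_{M<N} ℓ_M = log q_0 − log q_N`. [folklore] -/
theorem sum_oddsInc (N : ℕ) (U : GaugeField (F.P J) 0 (Matrix.specialUnitaryGroup (Fin 2) ℂ)) :
    ∑ M ∈ Finset.range N, oddsInc F γ b₀ p₀ hJK M U =
      Real.log (partialDensityCan F γ b₀ p₀ hJK 0 U) - Real.log (partialDensityCan F γ b₀ p₀ hJK N U) := by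
  unfold oddsInc
  exact Finset.sum_range_sub' (fun M => Real.log (partialDensityCan F γ b₀ p₀ hJK M U)) N

/-- **THE LEDGER IDENTITY**: LFR♯ᶜ's function is the version term plus the sum of the per-scale increments up to the height-`J` scale. [folklore] -/
theorem log_sub_log_eq_ledger (ρ : GaugeField (F.P J) 0 (Matrix.specialUnitaryGroup (Fin 2) ℂ) → ℝ)
    (U : GaugeField (F.P J) 0 (Matrix.specialUnitaryGroup (Fin 2) ℂ)) :
    Real.log (ρ U) - Real.log (heightDensityCan F γ hJK (histGood F ℰp (θBal F.L γ b₀ p₀) K J) U) =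
      (Real.log (ρ U) - Real.log (heightDensityCan F γ hJK Set.univ U)) +
        ∑ M ∈ Finset.range (K - J + 1), oddsInc F γ b₀ p₀ hJK M U := by
  rw [sum_oddsInc, partialDensityCan_zero, partialDensityCan_of_lt F γ b₀ p₀ hJK (Nat.lt_succ_self _)]
  ring

end Ledger

/-! ## §3 The organ rows VERS · PREG · LEV and the first rung -/

section Organ

/-- **VERS · THE FULL DENSITY'S VERSION TERM IS CONSTANT ON THE WINDOW** (S/M, hand-ready): for every continuous positive window version `ρ` of the nested
law `ν_{K,J}`, `log ρ − log heightDensityCan^{univ}` is constant on the window `{PlaqSmall θ_J}` (both are versions of `dν_{K,J}/dHaar` up to the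
normalisation `Z_K`; the canonical version agrees with every continuous version on an open set: `Node00.canonVersion_eqOn_of_continuousOn`,
`Node00.canonVersion_eqOn_congr_ae`, `T3TiltDescent.integral_map_descendTo_restrict`).  Why it might fail: only a mismatch between the tower `ν` (iterated
`descend`) and the `descendTo`/`fieldShift` reading inside `heightDensity` — a bookkeeping identity of the trunk (the WREG F-port pens it for `histGood`).
[cite: Balaban1985UV3, (2) p.256, (6) p.257] -/
def FullVersionConstCan : Prop :=
  ∀ (F : T3Family) (γ b₀ p₀ : ℝ), 0 < γ →
    ∀ (ν : ℕ → (j : ℕ) → Measure (GaugeField (F.P j) 0 (Matrix.specialUnitaryGroup (Fin 2) ℂ))),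
      (∀ K, ν K K = T4GenFunBounds.gibbsMeasure (F.P K) ((F.scheme ℰp γ).β K)) →
      (∀ K j, j < K → ν K j = Measure.map (descend F ℰp j) (ν K (j + 1))) →
      ∀ (J K : ℕ) (hJK : J ≤ K) (ρ : GaugeField (F.P J) 0 (Matrix.specialUnitaryGroup (Fin 2) ℂ) → ℝ),
        (∀ U, PlaqSmall (θBal F.L γ b₀ p₀ J) U → 0 < ρ U) →
        ν K J = (fieldMeasure _ _ _).withDensity (fun U => ENNReal.ofReal (ρ U)) →
        ContinuousOn ρ {U | PlaqSmall (θBal F.L γ b₀ p₀ J) U} →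
        ∃ c : ℝ, ∀ U : GaugeField (F.P J) 0 (Matrix.specialUnitaryGroup (Fin 2) ℂ), PlaqSmall (θBal F.L γ b₀ p₀ J) U →
          Real.log (ρ U) - Real.log (heightDensityCan F γ hJK Set.univ U) = c

/-- **PREG · WINDOW POSITIVITY OF THE PARTIAL CANONICAL DENSITIES** (S/M, hand-ready: WREG's pens — fibre continuity of `U ↦ ∫_{fibre U} 1_{S} e^{−βA}`
for the depth-filtered events, canonical version = the continuous one on the open window, positivity from `q_M ≥ q^{histGood} > 0` a.e. + continuity):
given positivity of the canonical small-history density on the window, every `q_M` is positive there.  Why it might fail: continuity of the partially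
constrained fibre density needs the boundary of `histGoodBelow M` to be fibre-null (plaquette variables of averaged fields have no atoms) — routine but
not yet in the tree for `M ≤ K − J`. [cite: Balaban1985UV3, (6)-(7) p.257] -/
def PartialWindowPositivityCan : Prop :=
  ∀ (L : ℕ), ∃ pS : ℝ, ∀ (b₀ p₀ : ℝ), 0 < b₀ → pS ≤ p₀ → 0 < p₀ →
    ∃ γ₁ : ℝ, 0 < γ₁ ∧ ∀ (F : T3Family) (γ : ℝ), F.L = L → 0 < γ → γ ≤ γ₁ →
      ∀ (J K : ℕ) (hJK : J ≤ K),
        (∀ U : GaugeField (F.P J) 0 (Matrix.specialUnitaryGroup (Fin 2) ℂ), PlaqSmall (θBal F.L γ b₀ p₀ J) U →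
            0 < heightDensityCan F γ hJK (histGood F ℰp (θBal F.L γ b₀ p₀) K J) U) →
        ∀ (M : ℕ) (U : GaugeField (F.P J) 0 (Matrix.specialUnitaryGroup (Fin 2) ℂ)), PlaqSmall (θBal F.L γ b₀ p₀ J) U →
          0 < partialDensityCan F γ b₀ p₀ hJK M U

/-- **LEV · THE PER-SCALE PINNED LEDGER BUDGET** (XL — this line's organ; print's large-field mechanism read one scale at a time, in INEQUALITY currency):
thresholds `pS ≤ p₀`, `γ ≤ γ₁`, a rate `κ > 0`, a budget `w_J(r) ≥ 0` with UNIFORM partial sums `Σ_{r<R} w_J(r) ≤ ψ_J`, `J·ψ_J → 0`, such that for every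
run `K`, height `J ≤ K` (partial densities positive on the window) and every constrained depth `M ≤ K − J`, on window quadruples moved at `b`, `b′`:
`|fourPt ℓ_M| ≤ w_J(K − J − M)·e^{−κ·tdist(b,b′)}` — TAIL (a depth-`M` plaquette large while all finer fields are small is a Gaussian large deviation of the
fluctuation field: `e^{−c·p(g_{J+r})²}`, `r = K − J − M`) × ENTROPY (`L^{3r}` depth-`M` plaquettes per height-`J` cell) × MIXING (the conditional fluctuation
measure above a window field has unit gap from the averaging constraint: pinned three-point decay `e^{−κ(tdist(x,b)+tdist(x,b′))}` summed over the pin `x`).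
Why it might fail: (i) inside each increment the COARSER depths `M < j ≤ K − J` are integrated FREE, large fields included — their control is Bałaban's
multi-scale R-operation ([Balaban1985UV3] (38)–(47); [Balaban1989LargeFieldII] (1.90)–(1.101)), the conserved wall, here needed only as an inequality;
(ii) the mixing rate `κ` must be uniform in the depth and in the free coarse levels; (iii) at `2·p₀ ≤ 1` the entropy `L^{3r}` beats the tail — hence `pS`.
THRESHOLD SENTENCE (critic #376 P2): `pS` is EXACTLY the exponent threshold at which ENTROPY `L^{3r}` × TAIL `e^{−c b₀² p(g_{J+r})²}` turns summable in `r` with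
`J·ψ_J → 0` (LFR♯ᶜ quantifies over every `b₀ > 0`, so `2·pS > 1` is forced), and the SAME `pS` must serve PREG `PartialWindowPositivityCan` — the composition
`largeFieldFourPtCan_of_ledger` takes `max pP pL` (kernel-checked), so hands must not tune the two thresholds apart: prove PREG for every `p₀` above LEV's `pS`.
[cite: Balaban1985UV3, (38)-(47) p.266-267; Balaban1989LargeFieldII, (1.90)-(1.101)] -/
def LevelOddsLedgerCan : Prop :=
  ∀ (L : ℕ), ∃ pS : ℝ, ∀ (b₀ p₀ : ℝ), 0 < b₀ → pS ≤ p₀ → 0 < p₀ →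
    ∃ γ₁ : ℝ, 0 < γ₁ ∧ ∃ κ : ℝ, 0 < κ ∧ ∀ (F : T3Family) (γ : ℝ), F.L = L → 0 < γ → γ ≤ γ₁ →
      ∃ w : ℕ → ℕ → ℝ, (∀ J r, 0 ≤ w J r) ∧
        ∃ ψ : ℕ → ℝ, (∀ J, 0 ≤ ψ J) ∧ Tendsto (fun J : ℕ => (J : ℝ) * ψ J) atTop (𝓝 0) ∧
          (∀ J R, ∑ r ∈ Finset.range R, w J r ≤ ψ J) ∧
          ∀ (J K : ℕ) (hJK : J ≤ K),
            (∀ (M : ℕ) (U : GaugeField (F.P J) 0 (Matrix.specialUnitaryGroup (Fin 2) ℂ)), PlaqSmall (θBal F.L γ b₀ p₀ J) U →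
                0 < partialDensityCan F γ b₀ p₀ hJK M U) →
            ∀ (M : ℕ), M + J ≤ K →
              ∀ (b b' : PBond (F.P J) 0) (U V W Z : GaugeField (F.P J) 0 (Matrix.specialUnitaryGroup (Fin 2) ℂ)),
                PlaqSmall (θBal F.L γ b₀ p₀ J) U → PlaqSmall (θBal F.L γ b₀ p₀ J) V →
                PlaqSmall (θBal F.L γ b₀ p₀ J) W → PlaqSmall (θBal F.L γ b₀ p₀ J) Z →
                (∀ e, e ≠ b → U e = V e) → (∀ e, e ≠ b' → U e = W e) → (∀ e, e ≠ b' → V e = Z e) → (∀ e, e ≠ b → W e = Z e) →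
                |fourPt (oddsInc F γ b₀ p₀ hJK M) U V W Z| ≤ w J (K - J - M) * Real.exp (-(κ * (b.src.tdist b'.src : ℝ)))

/-- **LEV₁ · FIRST RUNG (hands' entry): THE LEDGER AT DEPTH ONE** — LEV on the runs `K = J + 1`: above a window field at height `J` there is ONE free level,
the increment `M = 0` is the UNCONDITIONED odds that the run-`(J+1)` field has a plaquette outside `θ(J+1)` under the ONE-STEP constrained fluctuation measure
over the fibre (a Gaussian-tail × one-step-mixing statement: the tree's one-step tools — unit-lattice covariance `(Δ_N + Q_bᵀQ_b)⁻¹` with its Combes–Thomas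
decay, the `LocalPerturbation*` cluster engine, a Chernoff bound — are the pens), and `M = 1` is the window's own (trivial) constraint.
[cite: Balaban1985UV3, (38)-(40) p.266] -/
def DepthOneOddsCan : Prop :=
  ∀ (L : ℕ), ∃ pS : ℝ, ∀ (b₀ p₀ : ℝ), 0 < b₀ → pS ≤ p₀ → 0 < p₀ →
    ∃ γ₁ : ℝ, 0 < γ₁ ∧ ∃ κ : ℝ, 0 < κ ∧ ∀ (F : T3Family) (γ : ℝ), F.L = L → 0 < γ → γ ≤ γ₁ →
      ∃ w : ℕ → ℕ → ℝ, (∀ J r, 0 ≤ w J r) ∧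
        ∃ ψ : ℕ → ℝ, (∀ J, 0 ≤ ψ J) ∧ Tendsto (fun J : ℕ => (J : ℝ) * ψ J) atTop (𝓝 0) ∧
          (∀ J R, ∑ r ∈ Finset.range R, w J r ≤ ψ J) ∧
          ∀ (J : ℕ),
            (∀ (M : ℕ) (U : GaugeField (F.P J) 0 (Matrix.specialUnitaryGroup (Fin 2) ℂ)), PlaqSmall (θBal F.L γ b₀ p₀ J) U →
                0 < partialDensityCan F γ b₀ p₀ (Nat.le_succ J) M U) →
            ∀ (M : ℕ), M ≤ 1 →
              ∀ (b b' : PBond (F.P J) 0) (U V W Z : GaugeField (F.P J) 0 (Matrix.specialUnitaryGroup (Fin 2) ℂ)),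
                PlaqSmall (θBal F.L γ b₀ p₀ J) U → PlaqSmall (θBal F.L γ b₀ p₀ J) V →
                PlaqSmall (θBal F.L γ b₀ p₀ J) W → PlaqSmall (θBal F.L γ b₀ p₀ J) Z →
                (∀ e, e ≠ b → U e = V e) → (∀ e, e ≠ b' → U e = W e) → (∀ e, e ≠ b' → V e = Z e) → (∀ e, e ≠ b → W e = Z e) →
                |fourPt (oddsInc F γ b₀ p₀ (Nat.le_succ J) M) U V W Z| ≤ w J (1 - M) * Real.exp (-(κ * (b.src.tdist b'.src : ℝ)))

/-- LEV ⇒ LEV₁ (the first rung is the `K = J + 1` instance). [folklore] -/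
theorem depthOneOdds_of_ledger (h : LevelOddsLedgerCan) : DepthOneOddsCan := by
  intro L
  obtain ⟨pS, h⟩ := h L
  refine ⟨pS, fun b₀ p₀ hb₀ hp hp₀ => ?_⟩
  obtain ⟨γ₁, hγ₁, κ, hκ, h⟩ := h b₀ p₀ hb₀ hp hp₀
  refine ⟨γ₁, hγ₁, κ, hκ, fun F γ hFL hγ hγ₁' => ?_⟩
  obtain ⟨w, hw, ψ, hψ, hψt, hwψ, h⟩ := h F γ hFL hγ hγ₁'
  refine ⟨w, hw, ψ, hψ, hψt, hwψ, fun J hpos M hM b b' U V W Z hU hV hW hZ h1 h2 h3 h4 => ?_⟩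
  have hMK : M + J ≤ J + 1 := by omega
  have h' := h J (J + 1) (Nat.le_succ J) hpos M hMK b b' U V W Z hU hV hW hZ h1 h2 h3 h4
  have hidx : J + 1 - J - M = 1 - M := by omega
  rw [hidx] at h'
  exact h'

/-! ### §3b (v1.3) THE ROWS OF RECORD AFTER THE HANDS' KNITS: PREG′ · PWREG-int · LEV-below

Since v1.2 the cell landed, importably: ✓`…OddsLedgerVers.fullVersionConstCan` (VERS, p752318); ✓`…OddsLedgerReduction` (LFR♯ᶜ ⟸ PREG ∧ LEV and
⟸ PREG′ ∧ LEV, p753482∕p754135, VERS consumed inside); ✓`…OddsLedgerPregLow`∕`…PregTop`∕`…PregEnds` (PREG′ at both ends of the ledger, at every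
depth on the first rung, and at all depths from interior window-regularity PWREG-int alone); ✓`…OddsLedgerTopIncrement` (the top increment vanishes on
the window; the door LEV ⟸ LEV-below).  PREG AS LETTERED (`PartialWindowPositivityCan` above: positivity for EVERY `p₀ ≥ pS` with no `(ν, ρ)` in
scope) is RULING №32 (α′)-class at the low depths (★★OWNER WORD 62 (a)) and is NO LONGER A ROW; the rows below are copied BYTE-FOR-BYTE from the
landed theorems' binders (so the doors are `fun h => thm h`). -/

/-- **PREG′ · PREG INSIDE LFR♯ᶜ's OWN `(ν, ρ)`-CONTEXT** (= the conclusion of ✓`…OddsLedgerPregEnds.partialWindowPositivity_of_interiorRegSet`, verbatim;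
= hypothesis `hP` of ✓`…OddsLedgerReduction.largeFieldFourPtCan_of_partialWindowPositivity'_of_levelOddsLedger`).  Holds outright on the first rung
(✓`…PregEnds.partialWindowPositivity_depthOne`) and at the two ends of the ledger (✓`…partialWindowPositivity_ends`); in general ⟸ PWREG-int (below).
[cite: Balaban1985UV3, (2) p.256, (7) p.257, (41) p.266] -/
def PartialWindowPositivity'Can : Prop :=
  ∀ (L : ℕ), ∃ pS : ℝ, ∀ (b₀ p₀ : ℝ), 0 < b₀ → pS ≤ p₀ → 0 < p₀ →
    ∃ γ₁ : ℝ, 0 < γ₁ ∧ ∀ (F : T3Family) (γ : ℝ), F.L = L → 0 < γ → γ ≤ γ₁ →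
      ∀ (ν : ℕ → (j : ℕ) → Measure (GaugeField (F.P j) 0 (Matrix.specialUnitaryGroup (Fin 2) ℂ))),
        (∀ K, ν K K = T4GenFunBounds.gibbsMeasure (F.P K) ((F.scheme ℰp γ).β K)) →
        (∀ K j, j < K → ν K j = Measure.map (descend F ℰp j) (ν K (j + 1))) →
        ∀ (J K : ℕ) (hJK : J ≤ K) (ρ : GaugeField (F.P J) 0 (Matrix.specialUnitaryGroup (Fin 2) ℂ) → ℝ),
          (∀ U, PlaqSmall (θBal F.L γ b₀ p₀ J) U → 0 < ρ U) →
          ν K J = (fieldMeasure _ _ _).withDensity (fun U => ENNReal.ofReal (ρ U)) →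
          ContinuousOn ρ {U | PlaqSmall (θBal F.L γ b₀ p₀ J) U} →
          (∀ U : GaugeField (F.P J) 0 (Matrix.specialUnitaryGroup (Fin 2) ℂ), PlaqSmall (θBal F.L γ b₀ p₀ J) U →
              0 < heightDensityCan F γ hJK (histGood F ℰp (θBal F.L γ b₀ p₀) K J) U) →
          ∀ (M : ℕ) (U : GaugeField (F.P J) 0 (Matrix.specialUnitaryGroup (Fin 2) ℂ)), PlaqSmall (θBal F.L γ b₀ p₀ J) U →
            0 < heightDensityCan F γ hJK {U' : GaugeField (F.P K) 0 (Matrix.specialUnitaryGroup (Fin 2) ℂ) | ∀ j, j + J ≤ K → j < M →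
              PlaqSmall (θBal F.L γ b₀ p₀ (K - j)) (Averaging.iter (fun i => BlockAveraging.blockAvg (P := F.P K) (j := i) ℰp) j U')} U

/-- **PWREG-int · INTERIOR WINDOW-REGULARITY** (the residual positivity row of record, ★★OWNER WORD 62 (c); = hypothesis `hint` of
✓`…OddsLedgerPregEnds.partialWindowPositivity_of_interiorRegSet`, verbatim): at the INTERIOR depths `0 < M < K − J` the window `{PlaqSmall θ_J}` lies in
the regular set of the depth-filtered height density `heightDensity^{histGoodBelow M}` (free LARGE fields at the depths `M … K − J − 1`, outside the charted
set of the WREG port).  EMPTY on the first rung `K = J + 1`.  Why it might fail: a regularity statement for partially constrained fibre densities through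
uncharted large fields — unlocated in print ([Balaban1985UV3] (38)–(47) territory); size XL as a statement about all depths, but only REGULARITY (no rate).
[cite: Balaban1985UV3, (7) p.257, (38)-(47) p.266-267; Balaban1987RG1, (0.13) p.254, (2.10) p.267] -/
def InteriorWindowRegularityCan : Prop :=
  ∀ (L : ℕ), ∃ pS : ℝ, ∀ (b₀ p₀ : ℝ), 0 < b₀ → pS ≤ p₀ → 0 < p₀ →
        ∃ γ₁ : ℝ, 0 < γ₁ ∧ ∀ (F : T3Family) (γ : ℝ), F.L = L → 0 < γ → γ ≤ γ₁ →
          ∀ (J K : ℕ) (hJK : J ≤ K) (M : ℕ), 0 < M → M < K - J →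
            {V : GaugeField (F.P J) 0 (Matrix.specialUnitaryGroup (Fin 2) ℂ) | PlaqSmall (θBal F.L γ b₀ p₀ J) V} ⊆
              Node00.regSet (fieldMeasure (F.P J) 0 (Matrix.specialUnitaryGroup (Fin 2) ℂ))
                (heightDensity F γ hJK
                  {U' : GaugeField (F.P K) 0 (Matrix.specialUnitaryGroup (Fin 2) ℂ) | ∀ j, j + J ≤ K → j < M →
                    PlaqSmall (θBal F.L γ b₀ p₀ (K - j)) (Averaging.iter (fun i => BlockAveraging.blockAvg (P := F.P K) (j := i) ℰp) j U')})

/-- **LEV-below · THE LEDGER BUDGET AT THE DEPTHS WITH A FREE TRANSPORT** (= hypothesis `h` of ✓`…OddsLedgerTopIncrement.levelOddsLedger_of_below`,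
verbatim: LEV's text written out over ✓WregGlue's `heightDensityCan`, depth guard strengthened to `M + J < K`; the missing top depth `M = K − J` is
✓`oddsInc_top_eq_zero_on_window`).  On the first rung the single depth `M = 0` remains = the one-step large-field odds of the finest field (LEV₁'s content).
Why it might fail: as LEV (i)–(iii) above — the free coarse depths inside each increment are Bałaban's R-operation wall read as an inequality; `κ` uniform
in depth; `2·pS > 1`. [cite: Balaban1985UV3, (38)-(47) p.266-267; Balaban1989LargeFieldII, (1.90)-(1.101)] -/
def LevelOddsLedgerBelowCan : Prop :=
  ∀ (L : ℕ), ∃ pS : ℝ, ∀ (b₀ p₀ : ℝ), 0 < b₀ → pS ≤ p₀ → 0 < p₀ →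
        ∃ γ₁ : ℝ, 0 < γ₁ ∧ ∃ κ : ℝ, 0 < κ ∧ ∀ (F : T3Family) (γ : ℝ), F.L = L → 0 < γ → γ ≤ γ₁ →
          ∃ w : ℕ → ℕ → ℝ, (∀ J r, 0 ≤ w J r) ∧
            ∃ ψ : ℕ → ℝ, (∀ J, 0 ≤ ψ J) ∧ Tendsto (fun J : ℕ => (J : ℝ) * ψ J) atTop (𝓝 0) ∧
              (∀ J R, ∑ r ∈ Finset.range R, w J r ≤ ψ J) ∧
              ∀ (J K : ℕ) (hJK : J ≤ K),
                (∀ (M : ℕ) (U : GaugeField (F.P J) 0 (Matrix.specialUnitaryGroup (Fin 2) ℂ)), PlaqSmall (θBal F.L γ b₀ p₀ J) U →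
                    0 < heightDensityCan F γ hJK
                      {U' : GaugeField (F.P K) 0 (Matrix.specialUnitaryGroup (Fin 2) ℂ) | ∀ j, j + J ≤ K → j < M →
                        PlaqSmall (θBal F.L γ b₀ p₀ (K - j)) (Averaging.iter (fun i => BlockAveraging.blockAvg (P := F.P K) (j := i) ℰp) j U')} U) →
                ∀ (M : ℕ), M + J < K →
                  ∀ (b b' : PBond (F.P J) 0) (U V W Z : GaugeField (F.P J) 0 (Matrix.specialUnitaryGroup (Fin 2) ℂ)),
                    PlaqSmall (θBal F.L γ b₀ p₀ J) U → PlaqSmall (θBal F.L γ b₀ p₀ J) V →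
                    PlaqSmall (θBal F.L γ b₀ p₀ J) W → PlaqSmall (θBal F.L γ b₀ p₀ J) Z →
                    (∀ e, e ≠ b → U e = V e) → (∀ e, e ≠ b' → U e = W e) → (∀ e, e ≠ b' → V e = Z e) → (∀ e, e ≠ b → W e = Z e) →
                    letI ℓ : GaugeField (F.P J) 0 (Matrix.specialUnitaryGroup (Fin 2) ℂ) → ℝ := fun X =>
                      Real.log (heightDensityCan F γ hJK
                        {U' : GaugeField (F.P K) 0 (Matrix.specialUnitaryGroup (Fin 2) ℂ) | ∀ j, j + J ≤ K → j < M →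
                          PlaqSmall (θBal F.L γ b₀ p₀ (K - j)) (Averaging.iter (fun i => BlockAveraging.blockAvg (P := F.P K) (j := i) ℰp) j U')} X) -
                      Real.log (heightDensityCan F γ hJK
                        {U' : GaugeField (F.P K) 0 (Matrix.specialUnitaryGroup (Fin 2) ℂ) | ∀ j, j + J ≤ K → j < M + 1 →
                          PlaqSmall (θBal F.L γ b₀ p₀ (K - j)) (Averaging.iter (fun i => BlockAveraging.blockAvg (P := F.P K) (j := i) ℰp) j U')} X)
                    |(ℓ U - ℓ V) - (ℓ W - ℓ Z)| ≤ w J (K - J - M) * Real.exp (-(κ * (b.src.tdist b'.src : ℝ)))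

end Organ

/-! ## §4 THE COMPOSITION (PROVED): VERS + PREG + LEV ⇒ LFR♯ᶜ -/

section Composition

/-- **THE LEDGER SUFFICES** — `VERS → PREG → LEV → LFR♯ᶜ` as ONE proposition (wrapped in a `def` so that the skeleton register sees exactly one
zero-hypothesis theorem concluding the organ BY NAME, `largeFieldFourPtCan_of_stubs`; the register takes the first theorem whose conclusion head is the
organ and rejects un-registered `Prop` binders). [cite: Balaban1985UV3, (41) p.266] -/
def LedgerSuffices : Prop :=
  FullVersionConstCan → PartialWindowPositivityCan → LevelOddsLedgerCan → LargeFieldFourPtCan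

/-- **LFR♯ᶜ FROM THE ODDS LEDGER** (PROVED): telescope (§2), `fourPt` additivity, VERS kills the version term, triangle inequality over the scales,
reflect the budget index, the uniform partial-sum bound. [cite: Balaban1985UV3, (41) p.266] -/
theorem largeFieldFourPtCan_of_ledger : LedgerSuffices := by
  intro hV hP hL L
  obtain ⟨pP, hP⟩ := hP L
  obtain ⟨pL, hL⟩ := hL L
  refine ⟨max pP pL, fun b₀ p₀ hb₀ hp hp₀ => ?_⟩
  obtain ⟨γP, hγP, hP⟩ := hP b₀ p₀ hb₀ ((le_max_left _ _).trans hp) hp₀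
  obtain ⟨γL, hγL, κ, hκ, hL⟩ := hL b₀ p₀ hb₀ ((le_max_right _ _).trans hp) hp₀
  refine ⟨min γP γL, lt_min hγP hγL, κ, hκ, fun F γ hFL hγ hγ₁ => ?_⟩
  obtain ⟨w, hw0, ψ, hψ0, hψt, hwψ, hL⟩ := hL F γ hFL hγ (hγ₁.trans (min_le_right _ _))
  have hP' := hP F γ hFL hγ (hγ₁.trans (min_le_left _ _))
  refine ⟨ψ, hψ0, hψt, ?_⟩
  intro ν hνK hνd J K hJK ρ hρ hνρ hρc hpos b b' U V W Z hU hV' hW hZ h1 h2 h3 h4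
  obtain ⟨c, hc⟩ := hV F γ b₀ p₀ hγ ν hνK hνd J K hJK ρ hρ hνρ hρc
  have hposM := hP' J K hJK hpos
  have key : (fun U => Real.log (ρ U) - Real.log (heightDensityCan F γ hJK (histGood F ℰp (θBal F.L γ b₀ p₀) K J) U)) =
      fun U => (Real.log (ρ U) - Real.log (heightDensityCan F γ hJK Set.univ U)) +
        ∑ M ∈ Finset.range (K - J + 1), oddsInc F γ b₀ p₀ hJK M U := by
    funext X
    exact log_sub_log_eq_ledger F γ b₀ p₀ hJK ρ X
  rw [key, fourPt_add, fourPt_finset_sum,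
    fourPt_eq_zero_of_const (fun U => Real.log (ρ U) - Real.log (heightDensityCan F γ hJK Set.univ U)) c
      (hc U hU) (hc V hV') (hc W hW) (hc Z hZ), zero_add]
  have hrefl := Finset.sum_range_reflect (fun r => w J r * Real.exp (-(κ * (b.src.tdist b'.src : ℝ)))) (K - J + 1)
  simp only [Nat.add_sub_cancel] at hrefl
  calc |∑ M ∈ Finset.range (K - J + 1), fourPt (oddsInc F γ b₀ p₀ hJK M) U V W Z|
      ≤ ∑ M ∈ Finset.range (K - J + 1), |fourPt (oddsInc F γ b₀ p₀ hJK M) U V W Z| := Finset.abs_sum_le_sum_abs _ _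
    _ ≤ ∑ M ∈ Finset.range (K - J + 1), w J (K - J - M) * Real.exp (-(κ * (b.src.tdist b'.src : ℝ))) := by
        refine Finset.sum_le_sum fun M hM => ?_
        have hMK : M + J ≤ K := by
          have := Finset.mem_range.mp hM
          omega
        exact hL J K hJK hposM M hMK b b' U V W Z hU hV' hW hZ h1 h2 h3 h4
    _ = ∑ r ∈ Finset.range (K - J + 1), w J r * Real.exp (-(κ * (b.src.tdist b'.src : ℝ))) := hrefl
    _ = (∑ r ∈ Finset.range (K - J + 1), w J r) * Real.exp (-(κ * (b.src.tdist b'.src : ℝ))) := by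
        rw [Finset.sum_mul]
    _ ≤ ψ J * Real.exp (-(κ * (b.src.tdist b'.src : ℝ))) :=
        mul_le_mul_of_nonneg_right (hwψ J (K - J + 1)) (Real.exp_nonneg _)

end Composition

/-! ## §4b (v1.3) THE DOORS OF RECORD (PROVED, by name): VERS ✓ · LEV ⟸ LEV-below · LFR♯ᶜ ⟸ PREG′ ∧ LEV (PREG′ ⟸ PWREG-int: landed, import deferred to v1.4) -/

section Doors

/-- VERS is a THEOREM: ✓`…OddsLedgerVers.fullVersionConstCan` (ym3-torus-px19 g11, p752318) closes the row BY NAME. -/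
theorem fullVersionConstCan_holds : FullVersionConstCan :=
  Summit.QuantumFields.YangMills.Theorems.FluctuationComparisonRegPrIntLOddsLedgerVers.fullVersionConstCan

/- PREG′ ⟸ PWREG-int is the LANDED theorem ✓`…OddsLedgerPregEnds.partialWindowPositivity_of_interiorRegSet` (ym3-torus-px16 g12, tree
`Theorems/FluctuationComparisonRegPrIntLOddsLedgerPregEnds.lean`); its olean was NOT YET BUILT on the farm when v1.3 was written (lean check rc 75 «unbuilt»), so the
one-line door `theorem partialWindowPositivity'_of_interior (h : InteriorWindowRegularityCan) : PartialWindowPositivity'Can := …partialWindowPositivity_of_interiorRegSet h`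
is deferred to v1.4 (add `import …OddsLedgerPregEnds` + that line; then `RecordSuffices'` := PWREG-int → LEV-below → LFR♯ᶜ).  Until then PREG′ itself is the row. -/

/-- LEV ⟸ LEV-below: ✓`…OddsLedgerTopIncrement.levelOddsLedger_of_below` (ym3-torus-px21 g12); the line's `LevelOddsLedgerCan` is the port's conclusion
up to `δ` (`partialDensityCan`∕`histGoodBelow`∕`oddsInc`∕`fourPt` unfold to the written-out text). -/
theorem levelOddsLedger_of_below (h : LevelOddsLedgerBelowCan) : LevelOddsLedgerCan :=
  Summit.QuantumFields.YangMills.Theorems.FluctuationComparisonRegPrIntLOddsLedgerTopIncrement.levelOddsLedger_of_below h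

/-- LFR♯ᶜ ⟸ PREG′ ∧ LEV: ✓`…OddsLedgerReduction.largeFieldFourPtCan_of_partialWindowPositivity'_of_levelOddsLedger` (ym3-torus-px19 g11, v1.1 p754135;
VERS consumed inside the port). -/
theorem largeFieldFourPtCan_of_preg'_of_lev (hP : PartialWindowPositivity'Can) (hL : LevelOddsLedgerCan) : LargeFieldFourPtCan :=
  Summit.QuantumFields.YangMills.Theorems.FluctuationComparisonRegPrIntLOddsLedgerReduction.largeFieldFourPtCan_of_partialWindowPositivity'_of_levelOddsLedger
    hP hL

/-- **THE v1.3 COMPOSITION OF RECORD**: PREG′ → LEV-below → LFR♯ᶜ (VERS, the top increment and the reduction are landed theorems; PREG′ ⟸ PWREG-int is landed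
too — ✓`…PregEnds` — and replaces PREG′ by PWREG-int in v1.4 once its olean is built). -/
def RecordSuffices : Prop :=
  PartialWindowPositivity'Can → LevelOddsLedgerBelowCan → LargeFieldFourPtCan

theorem largeFieldFourPtCan_of_record : RecordSuffices := fun hP hB =>
  largeFieldFourPtCan_of_preg'_of_lev hP (levelOddsLedger_of_below hB)

end Doors

/-! ## §5 Stubs (the hands' targets) and the registered composition -/

section Stubs

/-- VERS — CLOSED BY NAME (✓p752318); kept as a theorem so that the v1.2 composition `largeFieldFourPtCan_of_ledger` still has its first argument. -/
theorem stub_fullVersionConstCan : FullVersionConstCan := fullVersionConstCan_holds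

/-- ROW PREG′ (PREG inside LFR♯ᶜ's `(ν, ρ)` context; ✓ at both ends and on the first rung, ⟸ PWREG-int in general — all in ✓`…PregEnds`, olean pending on the
farm; v1.4 swaps this row for `InteriorWindowRegularityCan` through that door). -/
theorem stub_partialWindowPositivity'Can : PartialWindowPositivity'Can := by
  sorry

/-- ROW LEV-below (the ledger budget at the depths `M + J < K`; on the first rung: the single depth `M = 0`) — this line's organ. -/
theorem stub_levelOddsLedgerBelowCan : LevelOddsLedgerBelowCan := by
  sorry

/-- The UNIQUE theorem of this file concluding the organ LFR♯ᶜ `LargeFieldFourPtCan` by name (v1.3: from the two rows of record through the landed doors). -/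
theorem largeFieldFourPtCan_of_stubs : LargeFieldFourPtCan :=
  largeFieldFourPtCan_of_record stub_partialWindowPositivity'Can stub_levelOddsLedgerBelowCan

end Stubs

end Summit.QuantumFields.YangMills.Cruxes.FluctuationComparisonRegPrIntL.RunPairOrgan.OddsLedger
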